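import Summits.BirchSwinnertonDyer.BirchSwinnertonDyer.Theorems.EisensteinPrimesMazurMCOnX1RankZeroDeepWitness
import Literature.NumberTheory.EllipticCurves.CongruenceNumber
import HarnessLib

/-!
# Crux idea (bsd-eis-idea g8): the Eisenstein degree law and the adjoint dévissage through the torsion line

Crux `Theses.EisensteinPrimes.MazurMCOnX1RankZero` (stmt-BirchSwinnertonDyer-19035). Typed content:

* `EisensteinDegreeLawAt` / `EisensteinDegreeLaw` — the EMPIRICAL LAW found by this seat (Cremona
  `N < 5·10⁵`, optimal curves with a rational point of order `p ∈ {3,5,7}`, `p ∤ N`, `r_an = 0`: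
  `v_p(#Ш_an · ∏ c_ℓ) ≤ v_p(m_E) + 2 v_p(#E(ℚ)_tors) − 1`, 6 727 / 6 727 curves, the bound attained in
  every stratum) — an UPPER bound of the analytic Ш by the modular degree (= congruence number at
  `p ∤ N`, ARS Thm 2.1);
* `WindingDegreeFormulaAt` (K1, Hecke side) and `AdjointShaLowerBoundAt` (K2, Galois side) — the
  two conjectural halves of the identity `v_p(m_E) = 1 + t(N,p) + v_p(#Ш·∏c/#T²)` behind the law;
* the DOORS (proved): K1 ∧ K2 ⇒ `Typed.MissingLowerBoundAt W p` ⇒ `BSDp W p` ⇒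
  `Rank1ResidualX1Defs.MazurMainConjecture W p` at a rank-0 X1 pair (Wuthrich Prop. 21 upper half,
  Wuthrich Thm 16 + Greenberg Thm 4.1 converse, all by name from the tree);
* `orbitMap_conj` / `orbitMap_surjective_traceZero` (L0, proved): the linear algebra of the lever —
  for a matrix `g` fixing the line of `v` up to the scalar `c` (`g'` its inverse, eigenvalue `c⁻¹`),
  the orbit map `X ↦ X v` intertwines conjugation with `c⁻¹ · g`, and on trace-zero `2 × 2`
  matrices it is onto `k²`: `ad⁰ρ̄ ↠ ρ̄ ⊗ χ⁻¹` through the torsion line.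
-/

noncomputable section

open scoped Classical

open WeierstrassCurve Literature.NumberTheory.EllipticCurves
  Literature.NumberTheory.EllipticCurves.ModularForms
  Literature.NumberTheory.EllipticCurves.Rank1Residual
  Literature.NumberTheory.EllipticCurves.Rank1Residual.Typed
  Literature.NumberTheory.EllipticCurves.Greenberg1999
  Summit.BirchSwinnertonDyer.BirchSwinnertonDyer.Theorems.Rank1ResidualX1Defs
  Summit.BirchSwinnertonDyer.BirchSwinnertonDyer.Theorems.Rank1ResidualX1Converse

set_option linter.dupNamespace false
set_option autoImplicit false

namespace Summit.BirchSwinnertonDyer.BirchSwinnertonDyer.Cruxes.MazurMCOnX1RankZero.AdjointDevissage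

/-! ## §0. L0 — the orbit map through a stable line (linear algebra of the lever) -/

section OrbitMap

variable {k : Type*} [Field k] {n : Type*} [Fintype n] [DecidableEq n]

omit [DecidableEq n] in
/-- **Equivariance of the orbit map.** If `g' v = c • v` (the inverse `g'` of `g` acts on the stable
line `k v` by the scalar `c = χ(g)⁻¹`), then `(g X g') v = c • g (X v)`: the orbit map `X ↦ X v`
intertwines conjugation on `End` with `χ⁻¹ ⊗ ρ`. [folklore] -/
theorem orbitMap_conj (g X g' : Matrix n n k) (v : n → k) (c : k) (hv : g'.mulVec v = c • v) :
    (g * X * g').mulVec v = c • g.mulVec (X.mulVec v) := by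
  rw [← Matrix.mulVec_mulVec, ← Matrix.mulVec_mulVec, hv, Matrix.mulVec_smul, Matrix.mulVec_smul]

/-- **The orbit map is onto on trace-zero `2 × 2` matrices:** every `w ∈ k²` is `X e₁` for some `X`
with `trace X = 0` (take `X = (w₀ 0; w₁ −w₀)`), so `ad⁰ ↠ ρ̄ ⊗ χ⁻¹` with one-dimensional kernel
`{(0 b; 0 0)}`. [folklore] -/
theorem orbitMap_surjective_traceZero (w : Fin 2 → k) :
    ∃ X : Matrix (Fin 2) (Fin 2) k, X.trace = 0 ∧ X.mulVec (Pi.single 0 1) = w := by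
  refine ⟨!![w 0, 0; w 1, -(w 0)], ?_, ?_⟩
  · simp [Matrix.trace, Fin.sum_univ_two]
  · ext i
    fin_cases i <;> simp [Matrix.mulVec, dotProduct, Fin.sum_univ_two]

/-- The kernel of the orbit map on trace-zero `2 × 2` matrices is the line of `(0 1; 0 0)`:
`trace X = 0 ∧ X e₁ = 0 → X = X₀₁ • E₀₁`. [folklore] -/
theorem orbitMap_ker_traceZero (X : Matrix (Fin 2) (Fin 2) k) (htr : X.trace = 0)
    (hX : X.mulVec (Pi.single 0 1) = 0) : X = X 0 1 • !![(0 : k), 1; 0, 0] := by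
  have h0 : X 0 0 = 0 := by
    have := congr_fun hX 0
    simpa [Matrix.mulVec, dotProduct, Fin.sum_univ_two] using this
  have h1 : X 1 0 = 0 := by
    have := congr_fun hX 1
    simpa [Matrix.mulVec, dotProduct, Fin.sum_univ_two] using this
  have h2 : X 1 1 = 0 := by
    have : X 0 0 + X 1 1 = 0 := by simpa [Matrix.trace, Fin.sum_univ_two] using htr
    rw [h0, zero_add] at this; exact this
  ext i j
  fin_cases i <;> fin_cases j <;> simp [h0, h1, h2]

end OrbitMap

/-! ## §1. The Eisenstein degree law (typed; data-certified, not proved) -/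

/-- `D` realises the MODULAR DEGREE `m_E`: its degree is minimal among all parametrisation data with
the same newform (the optimality hypothesis of `modularDegree_dvd_congruenceNumber`). -/
def IsOptimalDatum {W : WeierstrassCurve ℚ} {N : ℕ} [NeZero N]
    (D : ModularParametrizationData W N) : Prop :=
  ∀ (W' : WeierstrassCurve ℚ) [W'.IsElliptic] (D' : ModularParametrizationData W' N),
    D'.f = D.f → D.modularDegree ≤ D'.modularDegree

/-- **Eisenstein degree law at a pair** (this seat's law; Cremona `N < 5·10⁵`, optimal curves with
`E[p]` reducible, `p ∈ {3,5,7}`, `p ∤ N`, `r_an = 0`: 0 exceptions in 17 538 curves — 6 727 with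
`p ∣ #E(ℚ)_tors`, 10 811 with a rational `p`-isogeny and `p ∤ #E(ℚ)_tors` — and attained in every
stratum): with `#Ш_an(W) = q`, `v_p(q) + v_p(∏ c_ℓ) ≤ v_p(m_E) + 1` — "at an Eisenstein prime the
analytic Ш and the Tamagawa numbers are visible in the modular degree up to one factor `p`". For
irreducible `E[p]` it fails (1 345 / 1 210 / 505 optimal curves with `p² ∣ #Ш_an`, `p ∤ m_E`). -/
def EisensteinDegreeLawAt (W : WeierstrassCurve ℚ) [W.IsElliptic] {N : ℕ} [NeZero N]
    (D : ModularParametrizationData W N) (p : ℕ) : Prop :=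
  ∀ q : ℚ, shaAn W = (q : ℂ) →
    padicValRat p q + padicValNat p W.tamagawaProduct ≤ (padicValNat p D.modularDegree : ℤ) + 1

/-- **Eisenstein degree law** (class-wide form on the optimal members of X1-type classes at rank 0;
CONJECTURE, census-certified 17 538 / 17 538). -/
def EisensteinDegreeLaw : Prop :=
  ∀ (W : WeierstrassCurve ℚ) [W.IsElliptic] [W.IsGloballyMinimal] (N : ℕ) [NeZero N]
    (D : ModularParametrizationData W N), IsOptimalDatum D →
    ∀ (p : ℕ) [Fact p.Prime], 3 ≤ p → ¬ p ∣ N → ¬ W.HasIrreducibleModPGaloisRep p →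
      W.analyticRank = 0 → EisensteinDegreeLawAt W D p

/-! ## §2. The two halves behind the law (the card's cruxes K1, K2), with the Hecke defect `t` -/

/-- **K1 — winding/degree formula** (Hecke = analytic side): `v_p(m_E) + 1 = t + v_p(#Ш_an·∏c)`,
`t` the EISENSTEIN DEFECT of `f_E` at `p` (definition request D1: the `𝔪`-primary length of the
cuspidal congruence module of `f` not accounted for by the winding element; data: `t = 0` at 74 %
of the `p = 5` pairs with no second reducible class at a level dividing `N`, `t ≥ 1` at 85 % of
those with one). As a Lean statement `t` is a parameter; §4 shows why it must be PINNED. -/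
def WindingDegreeFormulaAt (W : WeierstrassCurve ℚ) [W.IsElliptic] {N : ℕ} [NeZero N]
    (D : ModularParametrizationData W N) (p t : ℕ) : Prop :=
  ∃ q : ℚ, shaAn W = (q : ℂ) ∧
    (padicValNat p D.modularDegree : ℤ) + 1 = t + padicValRat p q + padicValNat p W.tamagawaProduct

/-- **K2 — adjoint Ш lower bound** (Galois side; Wiles–Lenstra `η ≤ #℘/℘²` + the torsion-line
dévissage of `H¹_f(ℚ, ad⁰ρ_f ⊗ ℚ_p/ℤ_p)` through `ad⁰ρ̄/𝔫 ≅ ρ̄ ⊗ χ⁻¹`, §0): every cuspidal congruence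
of `f_E` at the Eisenstein maximal ideal beyond the `t` defect ones is carried by `Ш(E)[p^∞]` or a
Tamagawa factor: `v_p(m_E) + 1 ≤ t + v_p(#Ш(E)) + v_p(∏ c_ℓ)`. -/
def AdjointShaLowerBoundAt (W : WeierstrassCurve ℚ) [W.IsElliptic] {N : ℕ} [NeZero N]
    (D : ModularParametrizationData W N) (p t : ℕ) : Prop :=
  (padicValNat p D.modularDegree : ℤ) + 1 ≤
    t + padicValNat p W.shaOrder + padicValNat p W.tamagawaProduct

/-! ## §3. Doors (proved) -/

section Doors

variable (W : WeierstrassCurve ℚ) [W.IsElliptic] {N : ℕ} [NeZero N]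
  (D : ModularParametrizationData W N) (p : ℕ) [Fact p.Prime]

omit [Fact p.Prime] in
/-- K1 gives the degree law (the law is the `≤` shadow of the formula, `t ≥ 0`). -/
theorem eisensteinDegreeLawAt_of_winding {t : ℕ} (h1 : WindingDegreeFormulaAt W D p t) :
    EisensteinDegreeLawAt W D p := by
  obtain ⟨q, hq, he⟩ := h1
  intro q' hq'
  have hqq : q' = q := by exact_mod_cast hq'.symm.trans hq
  subst hqq
  have ht : (0 : ℤ) ≤ t := by exact_mod_cast Nat.zero_le t
  linarith

omit [Fact p.Prime] in
/-- **K1 ∧ K2 ⇒ the missing lower half `ord_p #Ш_an ≤ ord_p #Ш`** (subtract). -/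
theorem missingLowerBoundAt_of_winding_of_adjoint {t : ℕ} (h1 : WindingDegreeFormulaAt W D p t)
    (h2 : AdjointShaLowerBoundAt W D p t) : MissingLowerBoundAt W p := by
  obtain ⟨q, hq, he⟩ := h1
  refine ⟨q, hq, ?_⟩
  unfold AdjointShaLowerBoundAt at h2
  linarith

variable [W.IsGloballyMinimal]

/-- **K1 ∧ K2 ⇒ `BSD(E,p)` at a rank-0 X1 pair** (upper half = Wuthrich 2014 Prop. 21 `hW`, with
GZK `hGZK` and modularity `hmod`, by name: `Typed.bsdp_of_missingLowerBoundAt_of_wuthrich`). -/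
theorem bsdp_of_winding_of_adjoint (hW : Wuthrich2014.sha_dvd_analyticSha)
    (hGZK : rank_eq_analyticRank_of_analyticRank_le_one) (hmod : hasEntireLFunction_rat)
    (hX1 : ClassX1 W p) (hr0 : W.analyticRank = 0) {t : ℕ}
    (h1 : WindingDegreeFormulaAt W D p t) (h2 : AdjointShaLowerBoundAt W D p t) : BSDp W p :=
  have hX' := isClassX1_of_classX1 hX1
  bsdp_of_missingLowerBoundAt_of_wuthrich W p hW hGZK hmod hX'.two_ne hr0
    hX'.not_hasAdditiveReduction (Or.inl hX'.not_hasIrreducibleModPGaloisRep)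
    (missingLowerBoundAt_of_winding_of_adjoint W D p h1 h2)

/-- **K1 ∧ K2 ⇒ the CRUX's conclusion at the pair**: `Rank1ResidualX1Defs.MazurMainConjecture W p`
at a rank-0 X1 pair, through `Rank1ResidualX1Converse.mazurMainConjecture_iff_bsdp` (Wuthrich
Thm 16 `hW16`, Greenberg Thm 4.1 `hGr`, modular parametrisation `hPar`, GZK). -/
theorem mazurMainConjecture_of_winding_of_adjoint (hW : Wuthrich2014.sha_dvd_analyticSha)
    (hGZK : rank_eq_analyticRank_of_analyticRank_le_one) (hmod : hasEntireLFunction_rat)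
    (hW16 : Wuthrich2014.charIdeal_dvd_padicLFunction) (hGr : greenberg_charValue_rankZero)
    (hPar : nonempty_modularParametrizationData)
    (hX1 : ClassX1 W p) (hr0 : W.analyticRank = 0) {t : ℕ}
    (h1 : WindingDegreeFormulaAt W D p t) (h2 : AdjointShaLowerBoundAt W D p t) :
    MazurMainConjecture W p :=
  (mazurMainConjecture_iff_bsdp hW16 hGr hPar hGZK W p hX1 hr0).mpr
    (bsdp_of_winding_of_adjoint W D p hW hGZK hmod hX1 hr0 h1 h2)

/-- **… transported along an isogeny** (the optimal member `W₀` carries `D`; the pair `(W, p)` is any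
rank-0 X1 pair of the class): class X1 and `r_an` move along `W ∼ W₀` (`ClassX1.of_isIsogenous`,
Faltings), §3 gives `BSD(W₀,p)`, Cassels' invariance `hCas` carries it to `W`, and the converse chain
turns it into Mazur's main conjecture at `(W, p)` — the shape of `X1.bsdp_of_deepWitnessAt`. -/
theorem mazurMainConjecture_of_winding_of_adjoint_of_isIsogenous
    (hW : Wuthrich2014.sha_dvd_analyticSha) (hGZK : rank_eq_analyticRank_of_analyticRank_le_one)
    (hmod : hasEntireLFunction_rat) (hCas : bsdRHS_eq_of_isIsogenous)
    (hW16 : Wuthrich2014.charIdeal_dvd_padicLFunction) (hGr : greenberg_charValue_rankZero)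
    (hPar : nonempty_modularParametrizationData)
    (W₀ : WeierstrassCurve ℚ) [W₀.IsElliptic] [W₀.IsGloballyMinimal] (hiso : IsIsogenous W W₀)
    (D₀ : ModularParametrizationData W₀ N) (hX1 : ClassX1 W p) (hr0 : W.analyticRank = 0) {t : ℕ}
    (h1 : WindingDegreeFormulaAt W₀ D₀ p t) (h2 : AdjointShaLowerBoundAt W₀ D₀ p t) :
    MazurMainConjecture W p := by
  have hX1' : ClassX1 W₀ p := ClassX1.of_isIsogenous hiso hX1
  have hr0' : W₀.analyticRank = 0 := (analyticRank_eq_of_isIsogenous' hiso) ▸ hr0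
  have h' : BSDp W₀ p := bsdp_of_winding_of_adjoint W₀ D₀ p hW hGZK hmod hX1' hr0' h1 h2
  obtain ⟨-, hfin'⟩ := hGZK W₀ (by omega)
  have hL' : W₀.entireLFunction 1 ≠ 0 := (W₀.analyticRank_eq_zero_iff_holds (hmod W₀)).mp hr0'
  have hlead : W₀.leadingLCoeff ≠ 0 := by
    rwa [W₀.leadingLCoeff_eq_of_analyticRank_eq_zero hr0']
  exact (mazurMainConjecture_iff_bsdp hW16 hGr hPar hGZK W p hX1 hr0).mpr
    (Wuthrich2014.bsdp_of_isIsogenous hCas hiso hfin' hlead h')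

end Doors

/-! ## §4. Honesty lemma: with `t` existential the pair (K1, K2) is only Law ∧ MissingLowerBound -/

/-- **Why the defect must be PINNED (anti-costume).** `∃ t, K1(t) ∧ K2(t)` is equivalent to the
degree law at the pair together with the missing lower half itself (given that `#Ш_an` is SOME
rational, which K1 asserts): so the content of the line is exactly a DEFINITION of `t` on the Hecke
side (D1) for which K1 and K2 are separately attackable — nothing is gained by quantifying it away. -/
theorem exists_winding_and_adjoint_iff (W : WeierstrassCurve ℚ) [W.IsElliptic] {N : ℕ} [NeZero N]
    (D : ModularParametrizationData W N) (p : ℕ) :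
    (∃ t : ℕ, WindingDegreeFormulaAt W D p t ∧ AdjointShaLowerBoundAt W D p t) ↔
      (EisensteinDegreeLawAt W D p ∧ (∃ q : ℚ, shaAn W = (q : ℂ)) ∧ MissingLowerBoundAt W p) := by
  constructor
  · rintro ⟨t, h1, h2⟩
    refine ⟨eisensteinDegreeLawAt_of_winding W D p h1, ?_,
      missingLowerBoundAt_of_winding_of_adjoint W D p h1 h2⟩
    obtain ⟨q, hq, -⟩ := h1
    exact ⟨q, hq⟩
  · rintro ⟨hlaw, ⟨q, hq⟩, ⟨q', hq', hle⟩⟩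
    have hqq : q' = q := by exact_mod_cast hq'.symm.trans hq
    subst hqq
    have hL := hlaw q' hq
    set m : ℤ := (padicValNat p D.modularDegree : ℤ) + 1 - padicValRat p q'
      - padicValNat p W.tamagawaProduct with hm
    have hm0 : 0 ≤ m := by rw [hm]; linarith
    refine ⟨m.toNat, ⟨q', hq, ?_⟩, ?_⟩
    · have : ((m.toNat : ℕ) : ℤ) = m := Int.toNat_of_nonneg hm0
      rw [this, hm]; ring
    · unfold AdjointShaLowerBoundAt
      have : ((m.toNat : ℕ) : ℤ) = m := Int.toNat_of_nonneg hm0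
      rw [this, hm]
      linarith

/-! ## §5. The thesis on the leaf, parametrised by the Hecke defect (typed target, not proved) -/

/-- **The card's thesis**, parametrised by a DEFECT FUNCTION `defect` on newforms (to be the
Eisenstein defect of D1 — a quantity of the `𝔪`-adic Hecke algebra of level `N`, blind to the
Selmer group of `E`): K1 and K2 hold with `t = defect f_E p` at every optimal rank-0 curve whose
`E[p]` is reducible, `p ≥ 3`, `p ∤ N`. PARTITION: X1 row A3 (both sub-leaves `χ = 1`, `χ ≠ 1`). -/
def AdjointDevissageOnX1Leaf
    (defect : ∀ {N : ℕ}, CuspForm (CongruenceSubgroup.Gamma0 N) 2 → ℕ → ℕ) : Prop :=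
  ∀ (W : WeierstrassCurve ℚ) [W.IsElliptic] [W.IsGloballyMinimal] (N : ℕ) [NeZero N]
    (D : ModularParametrizationData W N), IsOptimalDatum D →
    ∀ (p : ℕ) [Fact p.Prime], 3 ≤ p → ¬ p ∣ N → ¬ W.HasIrreducibleModPGaloisRep p →
      W.analyticRank = 0 →
      WindingDegreeFormulaAt W D p (defect D.f p) ∧ AdjointShaLowerBoundAt W D p (defect D.f p)

/-- **Optimal representative** (support; modularity + the strong Weil curve of the class; the level
is the conductor, prime to every good prime): every X1 pair `(W, p)` has an isogenous globally
minimal `W₀` with an optimal datum at a level `N` with `p ∤ N`. [cite: BCDT2001] -/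
def OptimalRepresentativeOnX1 : Prop :=
  ∀ (W : WeierstrassCurve ℚ) [W.IsElliptic] [W.IsGloballyMinimal] (p : ℕ) [Fact p.Prime],
    ClassX1 W p →
      ∃ (W₀ : WeierstrassCurve ℚ) (_ : W₀.IsElliptic) (_ : W₀.IsGloballyMinimal) (N : ℕ)
        (_ : NeZero N) (D : ModularParametrizationData W₀ N),
        IsIsogenous W W₀ ∧ IsOptimalDatum D ∧ ¬ p ∣ N

/-- **Leaf thesis + optimal representative ⇒ the CRUX** `MazurMCOnX1RankZero` (class-wide, every
pair of X1 ∩ {r_an = 0}), granted the published named facts. The route-level content is therefore: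
D1 (define the defect), K1, K2 — and nothing else. -/
theorem mazurMCOnX1RankZero_of_leaf
    (hW : Wuthrich2014.sha_dvd_analyticSha) (hGZK : rank_eq_analyticRank_of_analyticRank_le_one)
    (hmod : hasEntireLFunction_rat) (hCas : bsdRHS_eq_of_isIsogenous)
    (hW16 : Wuthrich2014.charIdeal_dvd_padicLFunction) (hGr : greenberg_charValue_rankZero)
    (hPar : nonempty_modularParametrizationData) (hOpt : OptimalRepresentativeOnX1)
    {defect : ∀ {N : ℕ}, CuspForm (CongruenceSubgroup.Gamma0 N) 2 → ℕ → ℕ}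
    (hLeaf : AdjointDevissageOnX1Leaf defect) :
    Summit.BirchSwinnertonDyer.BirchSwinnertonDyer.Theses.EisensteinPrimes.MazurMCOnX1RankZero := by
  intro W _ _ p _ hX1 hr0
  obtain ⟨W₀, hE₀, hM₀, N, hN, D₀, hiso, hopt, hpN⟩ := hOpt W p hX1
  have hX1' : ClassX1 W₀ p := ClassX1.of_isIsogenous hiso hX1
  have hr0' : W₀.analyticRank = 0 := (analyticRank_eq_of_isIsogenous' hiso) ▸ hr0
  have hred : ¬ W₀.HasIrreducibleModPGaloisRep p :=
    (isClassX1_of_classX1 hX1').not_hasIrreducibleModPGaloisRep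
  have hp3 : 3 ≤ p := by have := hX1'.1; omega
  obtain ⟨h1, h2⟩ := hLeaf W₀ N D₀ hopt p hp3 hpN hred hr0'
  exact mazurMainConjecture_of_winding_of_adjoint_of_isIsogenous W p hW hGZK hmod hCas hW16 hGr
    hPar W₀ hiso D₀ hX1 hr0 h1 h2

/-- The leaf thesis implies the degree law on its population (so the 17 538-curve census certifying
the law is the BC5-type witness of the thesis' `≤` half, and ONE optimal curve violating the law
refutes K1 for every defect function). -/
theorem eisensteinDegreeLaw_of_leaf
    {defect : ∀ {N : ℕ}, CuspForm (CongruenceSubgroup.Gamma0 N) 2 → ℕ → ℕ}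
    (h : AdjointDevissageOnX1Leaf defect) : EisensteinDegreeLaw := by
  intro W _ _ N _ D hD p _ hp hpN hred hr
  exact eisensteinDegreeLawAt_of_winding W D p (h W N D hD p hp hpN hred hr).1

end Summit.BirchSwinnertonDyer.BirchSwinnertonDyer.Cruxes.MazurMCOnX1RankZero.AdjointDevissage
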